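import Summits.Ventures.PercRepro.C025Profile
import Mathlib.Combinatorics.Matroid.Sum

/-!
# DISJOINT SUMS AND THE SECOND LEVEL: THE LEMMAS (night-3 g23)

Companion of `C025ProfileSecondRowDirectSum` (`proofs/NIGHT3-G23-SECONDROW.md` §1).  For Mathlib's
`Matroid.disjointSum` the rank is additive (`eRk_disjointSum`: `ρ_{M ⊕ N}(X) = ρ_M(X ∩ E_M) + ρ_N(X ∩ E_N)`, both
directions through the cardinalities of bases), the ground Finset is the union (`gr_disjointSum`), and the parts of
a set and of its complement are computed (`union_inter_gr_left`, `sdiff_inter_gr_left`, …).  The price of a set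
at level `u` is read off the rank of its complement (`(u+1)/(q+1)` at rank `u+1`, `1` at rank `u`, `0` below
`u`; `price_eq_div_of_eRk_sdiff_eq_succ`, `price_eq_one_of_eRk_sdiff_eq`, `price_eq_zero_of_eRk_sdiff_lt`).
Counting: the complementation injection `B ↦ E ∖ B` (`card_filter_eRk_sdiff_le`), the member sums of one summand
against its second level (`sum_G_le`: the row `(j, ρ−1)` for `j ≤ ρ−2`, the trivial row at `j = ρ−1`, the
complementation at `j ≥ ρ`), the top row summed over any set of ranks (`sum_sum_c_le`), and the two products
inside the second level of a disjoint sum (`card_levelSet_disjointSum_ge`).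
No `def`, no `instance`, no notation.  Axioms: standard.
-/
open scoped Matroid

namespace PercRepro

open Set Finset ThmH

namespace SecondRow

variable {α : Type} [DecidableEq α]

omit [DecidableEq α] in
/-- **Rank additivity on a disjoint sum**: `ρ_{M ⊕ N}(X) = ρ_M(X ∩ E_M) + ρ_N(X ∩ E_N)`. -/
theorem eRk_disjointSum (M N : Matroid α) (h : Disjoint M.E N.E) (X : Set α) :
    (M.disjointSum N h).eRk X = M.eRk (X ∩ M.E) + N.eRk (X ∩ N.E) := by
  apply le_antisymm
  · obtain ⟨J, hJ⟩ := (M.disjointSum N h).exists_isBasis' X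
    rw [hJ.eRk_eq_encard]
    have hJi := hJ.indep
    rw [Matroid.disjointSum_indep_iff] at hJi
    obtain ⟨h1, h2, h3⟩ := hJi
    have hsplit : J = (J ∩ M.E) ∪ (J ∩ N.E) := by
      rw [← Set.inter_union_distrib_left, Set.inter_eq_left.mpr h3]
    have hdisj : Disjoint (J ∩ M.E) (J ∩ N.E) :=
      Disjoint.mono Set.inter_subset_right Set.inter_subset_right h
    calc J.encard = ((J ∩ M.E) ∪ (J ∩ N.E)).encard := by rw [← hsplit]
      _ = (J ∩ M.E).encard + (J ∩ N.E).encard := Set.encard_union_eq hdisj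
      _ ≤ M.eRk (X ∩ M.E) + N.eRk (X ∩ N.E) := by
          gcongr
          · exact h1.encard_le_eRk_of_subset (Set.inter_subset_inter_left _ hJ.subset)
          · exact h2.encard_le_eRk_of_subset (Set.inter_subset_inter_left _ hJ.subset)
  · obtain ⟨I₁, hI₁⟩ := M.exists_isBasis' (X ∩ M.E)
    obtain ⟨I₂, hI₂⟩ := N.exists_isBasis' (X ∩ N.E)
    have hI₁E : I₁ ⊆ M.E := hI₁.indep.subset_ground
    have hI₂E : I₂ ⊆ N.E := hI₂.indep.subset_ground
    have hI₁X : I₁ ⊆ X := hI₁.subset.trans Set.inter_subset_left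
    have hI₂X : I₂ ⊆ X := hI₂.subset.trans Set.inter_subset_left
    have hind : (M.disjointSum N h).Indep (I₁ ∪ I₂) := by
      rw [Matroid.disjointSum_indep_iff]
      refine ⟨?_, ?_, Set.union_subset_union hI₁E hI₂E⟩
      · have : (I₁ ∪ I₂) ∩ M.E = I₁ := by
          rw [Set.union_inter_distrib_right, Set.inter_eq_left.mpr hI₁E,
            Set.disjoint_iff_inter_eq_empty.mp (Disjoint.mono_left hI₂E h.symm), Set.union_empty]
        rw [this]; exact hI₁.indep
      · have : (I₁ ∪ I₂) ∩ N.E = I₂ := by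
          rw [Set.union_inter_distrib_right, Set.inter_eq_left.mpr hI₂E,
            Set.disjoint_iff_inter_eq_empty.mp (Disjoint.mono_left hI₁E h), Set.empty_union]
        rw [this]; exact hI₂.indep
    have hdisj : Disjoint I₁ I₂ := Disjoint.mono hI₁E hI₂E h
    calc M.eRk (X ∩ M.E) + N.eRk (X ∩ N.E) = I₁.encard + I₂.encard := by
          rw [hI₁.eRk_eq_encard, hI₂.eRk_eq_encard]
      _ = (I₁ ∪ I₂).encard := (Set.encard_union_eq hdisj).symm
      _ ≤ (M.disjointSum N h).eRk X :=
          hind.encard_le_eRk_of_subset (Set.union_subset hI₁X hI₂X)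

omit [DecidableEq α] in
/-- The rank of a disjoint sum is the sum of the ranks. -/
theorem eRank_disjointSum (M N : Matroid α) (h : Disjoint M.E N.E) :
    (M.disjointSum N h).eRank = M.eRank + N.eRank := by
  rw [Matroid.eRank_def, Matroid.disjointSum_ground_eq, eRk_disjointSum, Matroid.eRank_def,
    Matroid.eRank_def, Set.union_inter_cancel_left, Set.union_inter_cancel_right]

/-- The ground Finset of a disjoint sum. -/
theorem gr_disjointSum (M N : Matroid α) [M.Finite] [N.Finite] (h : Disjoint M.E N.E)
    [(M.disjointSum N h).Finite] : gr (M.disjointSum N h) = gr M ∪ gr N := by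
  apply Finset.coe_injective
  rw [Finset.coe_union, coe_gr, coe_gr, coe_gr, Matroid.disjointSum_ground_eq]

section price

variable {M : Matroid α} [M.Finite]

/-- The price of `B` at level `u` when its complement has rank `u + 1`: `(u+1)/(q+1)`. -/
theorem price_eq_div_of_eRk_sdiff_eq_succ {q u : ℕ} {B : Finset α}
    (hB : M.eRk ((gr M \ B : Finset α) : Set α) = ((u + 1 : ℕ) : ℕ∞)) :
    Profile.price M q u B = ((u + 1 : ℕ) : ℚ) / ((q + 1 : ℕ) : ℚ) := by
  unfold Profile.price
  rw [hB, ENat.toNat_coe, if_pos (by exact_mod_cast Nat.le_succ u)]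
  have h1 : (u + 1 + q).choose u = (u + 1 + q).choose (q + 1) := by
    have : u + 1 + q = u + (q + 1) := by ring
    rw [this, Nat.choose_symm_add]
  have h2 : (u + 1 + q).choose (q + 1) * (q + 1) = (u + 1 + q).choose q * (u + 1) := by
    have := Nat.choose_succ_right_eq (u + 1 + q) q
    rwa [show u + 1 + q - q = u + 1 by omega] at this
  have hpos : (0 : ℚ) < ((u + 1 + q).choose q : ℚ) := by
    exact_mod_cast Nat.choose_pos (by omega)
  rw [h1, div_eq_div_iff hpos.ne' (by positivity)]
  rw [mul_comm ((u + 1 : ℕ) : ℚ)]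
  exact_mod_cast h2

/-- The price of `B` at level `u` when its complement has rank exactly `u`: `1`. -/
theorem price_eq_one_of_eRk_sdiff_eq {q u : ℕ} {B : Finset α}
    (hB : M.eRk ((gr M \ B : Finset α) : Set α) = (u : ℕ∞)) : Profile.price M q u B = 1 := by
  unfold Profile.price
  rw [hB, ENat.toNat_coe, if_pos le_rfl, Nat.choose_symm_add]
  have hpos : (0 : ℚ) < ((u + q).choose q : ℚ) := by exact_mod_cast Nat.choose_pos (by omega)
  exact div_self hpos.ne'

/-- The price of `B` at level `u` vanishes when its complement has rank `< u`. -/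
theorem price_eq_zero_of_eRk_sdiff_lt {q u : ℕ} {B : Finset α}
    (hB : M.eRk ((gr M \ B : Finset α) : Set α) < (u : ℕ∞)) : Profile.price M q u B = 0 := by
  unfold Profile.price
  rw [if_neg (not_le.mpr hB)]

/-- The price at the level of the members themselves is at most `1`. -/
theorem price_self_le_one (q : ℕ) (B : Finset α) : Profile.price M q q B ≤ 1 := by
  unfold Profile.price
  split_ifs with h
  · exact div_self_le_one _
  · exact zero_le_one

end price

section counting

variable {M : Matroid α} [M.Finite]

omit [DecidableEq α] in
/-- `Rq M j` is the level set of rank `j` (the two filters have the same predicate). -/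
theorem Rq_eq_levelSet (j : ℕ) : Profile.Rq M j = Shadow.levelSet M j := by
  ext B
  rw [Profile.mem_Rq, Profile.mem_levelSet]

/-- **Complementation**: among any family of subsets of `E`, those whose complement has rank `s` are at most the
sets of rank `s` (the injection `B ↦ E ∖ B`). -/
theorem card_filter_eRk_sdiff_le (𝒜 : Finset (Finset α)) (h𝒜 : 𝒜 ⊆ (gr M).powerset) (s : ℕ)
    [DecidablePred fun B : Finset α => M.eRk ((gr M \ B : Finset α) : Set α) = (s : ℕ∞)] :
    (𝒜.filter (fun B : Finset α => M.eRk ((gr M \ B : Finset α) : Set α) = (s : ℕ∞))).card ≤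
      (Shadow.levelSet M s).card := by
  apply Finset.card_le_card_of_injOn (fun B : Finset α => gr M \ B)
  · intro B hB
    rw [Finset.mem_coe, Finset.mem_filter] at hB
    rw [Finset.mem_coe, Profile.mem_levelSet]
    exact ⟨Finset.sdiff_subset, hB.2⟩
  · intro B hB B' hB' hBB'
    have h1 : B ⊆ gr M := Finset.mem_powerset.mp (h𝒜 (Finset.mem_filter.mp hB).1)
    have h2 : B' ⊆ gr M := Finset.mem_powerset.mp (h𝒜 (Finset.mem_filter.mp hB').1)
    have := congrArg (fun X : Finset α => gr M \ X) hBB'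
    simpa only [Finset.sdiff_sdiff_eq_self h1, Finset.sdiff_sdiff_eq_self h2] using this

omit [DecidableEq α] in
/-- Every set of rank `j` has `j ≤ ρ(E)`. -/
theorem le_of_mem_Rq {ρ : ℕ} (hρ : M.eRank = (ρ : ℕ∞)) {j : ℕ} {B : Finset α} (hB : B ∈ Profile.Rq M j) :
    j ≤ ρ := by
  have h := M.eRk_le_eRank (B : Set α)
  rw [(Profile.mem_Rq.mp hB).2, hρ] at h
  exact_mod_cast h

/-- **The member sums of one summand are bounded by its second level**: for every `j`, the sum over the rank-`j`
sets of the weight `G_j` (the price of the row `(j, ρ−1)` when `j < ρ`; the indicator «complement of rank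
`ρ−1`» when `j ≥ ρ`) is at most `#{S : ρ(S) = ρ−1}`. -/
theorem sum_G_le {ρ : ℕ} (h1 : 1 ≤ ρ)
    (hM : ∀ j, j + 2 ≤ ρ → Profile.ProfileIneq M j (ρ - 1)) (j : ℕ) :
    ∑ B ∈ Profile.Rq M j, (if j < ρ then Profile.price M j (ρ - 1) B
      else (if M.eRk ((gr M \ B : Finset α) : Set α) = ((ρ - 1 : ℕ) : ℕ∞) then (1 : ℚ) else 0)) ≤
      ((Shadow.levelSet M (ρ - 1)).card : ℚ) := by
  by_cases hj : j < ρ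
  · simp only [if_pos hj]
    rcases Nat.lt_or_ge (j + 1) ρ with hj2 | hj2
    · exact hM j (by omega)
    · have hjρ : j = ρ - 1 := by omega
      subst hjρ
      calc ∑ B ∈ Profile.Rq M (ρ - 1), Profile.price M (ρ - 1) (ρ - 1) B
          ≤ ∑ B ∈ Profile.Rq M (ρ - 1), (1 : ℚ) :=
            Finset.sum_le_sum (fun B _ => price_self_le_one (ρ - 1) B)
        _ = ((Shadow.levelSet M (ρ - 1)).card : ℚ) := by
            rw [Finset.sum_const, nsmul_eq_mul, mul_one, Rq_eq_levelSet]
  · simp only [if_neg hj]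
    rw [Finset.sum_boole]
    have := card_filter_eRk_sdiff_le (M := M) (Profile.Rq M j)
      (fun B hB => Finset.mem_powerset.mpr (Profile.mem_Rq.mp hB).1) (ρ - 1)
    exact_mod_cast this

/-- **The top row summed over several ranks**: for any finite set `J` of ranks, the sets of rank in `J` whose
complement is spanning are at most the spanning sets (`Rq M j` are pairwise disjoint). -/
theorem sum_sum_c_le (ρ : ℕ) (J : Finset ℕ) :
    ∑ j ∈ J, ∑ B ∈ Profile.Rq M j,
        (if M.eRk ((gr M \ B : Finset α) : Set α) = (ρ : ℕ∞) then (1 : ℚ) else 0) ≤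
      ((Shadow.levelSet M ρ).card : ℚ) := by
  have hdisj : (J : Set ℕ).PairwiseDisjoint (fun j => Profile.Rq M j) := by
    intro i _ k _ hik
    rw [Function.onFun, Finset.disjoint_left]
    intro B hBi hBk
    have hik' : (i : ℕ∞) = (k : ℕ∞) := (Profile.mem_Rq.mp hBi).2.symm.trans (Profile.mem_Rq.mp hBk).2
    exact hik (by exact_mod_cast hik')
  rw [← Finset.sum_biUnion hdisj]
  calc ∑ B ∈ J.biUnion (fun j => Profile.Rq M j),
        (if M.eRk ((gr M \ B : Finset α) : Set α) = (ρ : ℕ∞) then (1 : ℚ) else 0)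
      ≤ ∑ B ∈ (gr M).powerset,
        (if M.eRk ((gr M \ B : Finset α) : Set α) = (ρ : ℕ∞) then (1 : ℚ) else 0) := by
        apply Finset.sum_le_sum_of_subset_of_nonneg
        · intro B hB
          obtain ⟨j, _, hBj⟩ := Finset.mem_biUnion.mp hB
          exact Finset.mem_powerset.mpr (Profile.mem_Rq.mp hBj).1
        · intro B _ _
          split_ifs <;> norm_num
    _ ≤ ((Shadow.levelSet M ρ).card : ℚ) := by
        rw [Finset.sum_boole]
        exact_mod_cast card_filter_eRk_sdiff_le (M := M) (gr M).powerset (subset_refl _) ρ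

end counting

section sum

variable (M N : Matroid α) [M.Finite] [N.Finite]

omit [DecidableEq α] in
/-- The ground Finsets of the summands are disjoint. -/
theorem disjoint_gr (h : Disjoint M.E N.E) : Disjoint (gr M) (gr N) := by
  rw [← Finset.disjoint_coe, coe_gr, coe_gr]; exact h

/-- Rank additivity on the disjoint sum, for Finsets. -/
theorem eRk_disjointSum_finset (h : Disjoint M.E N.E) (B : Finset α) :
    (M.disjointSum N h).eRk (B : Set α) =
      M.eRk ((B ∩ gr M : Finset α) : Set α) + N.eRk ((B ∩ gr N : Finset α) : Set α) := by
  rw [eRk_disjointSum, Finset.coe_inter, Finset.coe_inter, coe_gr, coe_gr]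

/-- The `M`-part of a union of an `M`-set and an `N`-set. -/
theorem union_inter_gr_left (hd : Disjoint (gr M) (gr N)) {B₁ B₂ : Finset α} (hB₁ : B₁ ⊆ gr M)
    (hB₂ : B₂ ⊆ gr N) : (B₁ ∪ B₂) ∩ gr M = B₁ := by
  ext x
  simp only [Finset.mem_inter, Finset.mem_union]
  constructor
  · rintro ⟨hx | hx, hxM⟩
    · exact hx
    · exact absurd hxM (Finset.disjoint_right.mp hd (hB₂ hx))
  · intro hx
    exact ⟨Or.inl hx, hB₁ hx⟩

/-- The `N`-part of a union of an `M`-set and an `N`-set. -/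
theorem union_inter_gr_right (hd : Disjoint (gr M) (gr N)) {B₁ B₂ : Finset α} (hB₁ : B₁ ⊆ gr M)
    (hB₂ : B₂ ⊆ gr N) : (B₁ ∪ B₂) ∩ gr N = B₂ := by
  ext x
  simp only [Finset.mem_inter, Finset.mem_union]
  constructor
  · rintro ⟨hx | hx, hxN⟩
    · exact absurd hxN (Finset.disjoint_left.mp hd (hB₁ hx))
    · exact hx
  · intro hx
    exact ⟨Or.inr hx, hB₂ hx⟩

/-- The `M`-part of the complement of `B` in `E_M ∪ E_N`. -/
theorem sdiff_inter_gr_left (B : Finset α) : ((gr M ∪ gr N) \ B) ∩ gr M = gr M \ (B ∩ gr M) := by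
  ext x
  simp only [Finset.mem_inter, Finset.mem_sdiff, Finset.mem_union]
  tauto

/-- The `N`-part of the complement of `B` in `E_M ∪ E_N`. -/
theorem sdiff_inter_gr_right (B : Finset α) : ((gr M ∪ gr N) \ B) ∩ gr N = gr N \ (B ∩ gr N) := by
  ext x
  simp only [Finset.mem_inter, Finset.mem_sdiff, Finset.mem_union]
  tauto

/-- **The second level of a disjoint sum is at least the two products**: the unions of a level-`(ρ₁−1)` set of `M`
with a spanning set of `N` and of a spanning set of `M` with a level-`(ρ₂−1)` set of `N` are distinct sets of
rank `ρ₁+ρ₂−1` of `M ⊕ N`. -/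
theorem card_levelSet_disjointSum_ge (h : Disjoint M.E N.E) [(M.disjointSum N h).Finite]
    {ρ₁ ρ₂ : ℕ} (hρ₁ : 1 ≤ ρ₁) (hρ₂ : 1 ≤ ρ₂) :
    (Shadow.levelSet M (ρ₁ - 1)).card * (Shadow.levelSet N ρ₂).card +
        (Shadow.levelSet M ρ₁).card * (Shadow.levelSet N (ρ₂ - 1)).card ≤
      (Shadow.levelSet (M.disjointSum N h) (ρ₁ + ρ₂ - 1)).card := by
  have hgr : gr (M.disjointSum N h) = gr M ∪ gr N := gr_disjointSum M N h
  have hd : Disjoint (gr M) (gr N) := disjoint_gr M N h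
  have hdisjT : Disjoint (Shadow.levelSet M (ρ₁ - 1) ×ˢ Shadow.levelSet N ρ₂)
      (Shadow.levelSet M ρ₁ ×ˢ Shadow.levelSet N (ρ₂ - 1)) := by
    rw [Finset.disjoint_left]
    rintro ⟨B₁, B₂⟩ hp hp'
    rw [Finset.mem_product] at hp hp'
    have e1 := (Profile.mem_levelSet.mp hp.1).2
    have e2 := (Profile.mem_levelSet.mp hp'.1).2
    rw [e1] at e2
    have : ρ₁ - 1 = ρ₁ := by exact_mod_cast e2
    omega
  rw [← Finset.card_product, ← Finset.card_product, ← Finset.card_union_of_disjoint hdisjT]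
  apply Finset.card_le_card_of_injOn (fun p : Finset α × Finset α => p.1 ∪ p.2)
  · rintro ⟨B₁, B₂⟩ hp
    rw [Finset.mem_coe, Finset.mem_union, Finset.mem_product, Finset.mem_product] at hp
    rw [Finset.mem_coe, Profile.mem_levelSet, hgr]
    rcases hp with ⟨hB₁, hB₂⟩ | ⟨hB₁, hB₂⟩
    · obtain ⟨hB₁s, hB₁r⟩ := Profile.mem_levelSet.mp hB₁
      obtain ⟨hB₂s, hB₂r⟩ := Profile.mem_levelSet.mp hB₂
      refine ⟨Finset.union_subset_union hB₁s hB₂s, ?_⟩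
      rw [eRk_disjointSum_finset M N h, union_inter_gr_left M N hd hB₁s hB₂s,
        union_inter_gr_right M N hd hB₁s hB₂s, hB₁r, hB₂r, ← Nat.cast_add]
      congr 1
      omega
    · obtain ⟨hB₁s, hB₁r⟩ := Profile.mem_levelSet.mp hB₁
      obtain ⟨hB₂s, hB₂r⟩ := Profile.mem_levelSet.mp hB₂
      refine ⟨Finset.union_subset_union hB₁s hB₂s, ?_⟩
      rw [eRk_disjointSum_finset M N h, union_inter_gr_left M N hd hB₁s hB₂s,
        union_inter_gr_right M N hd hB₁s hB₂s, hB₁r, hB₂r, ← Nat.cast_add]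
      congr 1
      omega
  · rintro ⟨B₁, B₂⟩ hp ⟨B₁', B₂'⟩ hp' heq
    simp only at heq
    rw [Finset.mem_coe, Finset.mem_union, Finset.mem_product, Finset.mem_product] at hp hp'
    have hB₁s : B₁ ⊆ gr M := by
      rcases hp with ⟨hB₁, _⟩ | ⟨hB₁, _⟩ <;> exact (Profile.mem_levelSet.mp hB₁).1
    have hB₂s : B₂ ⊆ gr N := by
      rcases hp with ⟨_, hB₂⟩ | ⟨_, hB₂⟩ <;> exact (Profile.mem_levelSet.mp hB₂).1
    have hB₁s' : B₁' ⊆ gr M := by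
      rcases hp' with ⟨hB₁, _⟩ | ⟨hB₁, _⟩ <;> exact (Profile.mem_levelSet.mp hB₁).1
    have hB₂s' : B₂' ⊆ gr N := by
      rcases hp' with ⟨_, hB₂⟩ | ⟨_, hB₂⟩ <;> exact (Profile.mem_levelSet.mp hB₂).1
    have e1 : B₁ = B₁' := by
      rw [← union_inter_gr_left M N hd hB₁s hB₂s, heq, union_inter_gr_left M N hd hB₁s' hB₂s']
    have e2 : B₂ = B₂' := by
      rw [← union_inter_gr_right M N hd hB₁s hB₂s, heq, union_inter_gr_right M N hd hB₁s' hB₂s']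
    rw [e1, e2]

end sum

end SecondRow

end PercRepro
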